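import Summits.PneNP.PneNP.Theorems.SzkEntropyPeaWorstToAvgStubOrbitKitClose
import Summits.PneNP.PneNP.Theorems.SzkEntropyPeaWorstToAvgStubOrbitKitMachine
import HarnessLib

/-!
# Route SzkEntropy, crux `PeaWorstToAvg` (stmt-PneNP-10777), line `orbit-pair-rsr`: the stub `stub_orbitKit`

**The orbit kit exists** for every `P`-uniform pair of cubic families `p₀, p₁` with `s ≤ |p_b s|`: a
UNIFORM planted sampler of the size-`(n+1)` slice of the affine orbit of `p_b` and an in-orbit
re-randomiser whose law on every orbit point is `1/16`-close to the planted law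
(`Nonempty (OrbitKit p₀ p₁ k)`).  Both machines run ONE polynomial-time string function
(`OKit.coreFP`, `…StubOrbitKitMachine.lean`) computing the core map `OKit.core 16`: read a group
element `(A, b, B, c) ∈ AGL_s(F₂) × AGL_m(F₂)` off the coins (`16` candidates per matrix, first
invertible one, identity fallback — `…StubOrbitKitGLSampler.lean`) and output the CANONICAL algebraic
normal form of `(B·+c) ∘ q ∘ (A·+b)` (`…StubOrbitKitANF/Subst/Bridge.lean`); the planted sampler
applies it to the base instance `⟨n+1, (p_b (n+1), k (n+1))⟩` (in `FP` by `P`-uniformity), the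
re-randomiser to its input.  Support and closeness: `…StubOrbitKitBridge.lean` (the normal form
presents the affine action and depends only on the presented function) and `…StubOrbitKitClose.lean`
(translation under the near-uniform law of the read-out costs `≤ 2 (¾)^16 ≤ 1/16`).

References: Bogdanov–Trevisan, FnT–TCS 2 (2006), Def. 2.1; J. Patarin, EUROCRYPT 1996, §2;
Dvir–Gutfreund–Rothblum–Vadhan, ICS 2011, pp. 2–3; S. Arora, B. Barak, CUP 2009, §7.1.
-/

namespace Summit.PneNP.PneNP.Cruxes.PeaWorstToAvg.OrbitPairRsr

set_option linter.dupNamespace false -- Summit.PneNP.PneNP: summit = sub-problem (D-0017)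

open Literature.Computability.Complexity Literature.Computability.MetaComplexity
open _root_.Computability Summit.PneNP.PneNP.Theorems CodeFP Polynomial

namespace OKit

/-! ### Small facts about codes, lengths and budgets -/

/-- The number of candidates per matrix. [folklore] -/
def T : ℕ := 16

/-- `2 (¾)^16 ≤ 1/16`. [folklore] -/
theorem two_mul_pow_T_le : 2 * (3 / 4 : ℝ) ^ T ≤ 1 / 16 := by norm_num [T]

/-- Affinely equivalent maps have the same number of coordinates. [folklore] -/
theorem AffEquiv.length_eq {s : ℕ} {P Q : PolyMapF2 s} (h : AffEquiv P Q) : Q.length = P.length := by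
  obtain ⟨A, b, B, c, -, -, hx⟩ := h
  have := congrArg List.length (hx 0)
  simpa [affOut] using this

/-- A list is at most as long as the code of an instance carrying it (unary length header). [folklore] -/
theorem length_le_length_untypedCode (s j : ℕ) (Q : List (List (List ℕ))) :
    Q.length ≤ (PEAInst.untypedCode (s, (Q, j))).length := by
  simp only [PEAInst.untypedCode, pairE_apply, length_boolPair, listE, length_unE]
  omega

/-- The coin need is monotone. [folklore] -/
theorem need_mono {s s' m m' : ℕ} (hs : s ≤ s') (hm : m ≤ m') (t : ℕ) : need s m t ≤ need s' m' t := by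
  unfold need
  gcongr

/-- The coin need as a polynomial in two bounds. [folklore] -/
theorem need_le_eval (s m t : ℕ) :
    need s m t = (C t * X ^ 2 + X).eval s + (C t * X ^ 2 + X).eval m := by
  simp [need, sq]; ring

/-- **The samplers' coin budget**: one polynomial covering the coins read on both sides. [folklore] -/
theorem exists_sampCoins (M₀ M₁ : Polynomial ℕ) : ∃ c : Polynomial ℕ,
    ∀ n m, m ≤ M₀.eval (n + 1) + M₁.eval (n + 1) → need (n + 1) m T ≤ c.eval n := by
  refine ⟨(C T * X ^ 2 + X).comp (X + 1) + (C T * X ^ 2 + X).comp (M₀.comp (X + 1) + M₁.comp (X + 1)),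
    fun n m hm => ?_⟩
  calc need (n + 1) m T ≤ need (n + 1) (M₀.eval (n + 1) + M₁.eval (n + 1)) T := need_mono le_rfl hm T
    _ = _ := by rw [need_le_eval]; simp

/-- **The re-randomiser's coin budget.** [folklore] -/
theorem exists_rerCoins : ∃ c : Polynomial ℕ, ∀ s m ℓ, s ≤ ℓ → m ≤ ℓ → need s m T ≤ c.eval ℓ :=
  ⟨(C T * X ^ 2 + X) + (C T * X ^ 2 + X), fun s m ℓ hs hm =>
    calc need s m T ≤ need ℓ ℓ T := need_mono hs hm T
      _ = _ := by rw [need_le_eval]; simp⟩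

/-! ### Membership of the output in the orbit slice -/

/-- **The core map lands in the orbit slice.** If `q` (cubic, `|p s|` coordinates, `1 ≤ s ≤ |p s|`) is in
the affine orbit of the cubic `p s` via `g₀`, then for every coin string the core map sends the code of
`⟨s, (q, k s)⟩` to the code of an orbit instance of `p` of size `s`. [folklore] -/
theorem core_mem_side (p : (s : ℕ) → PolyMapF2 s) (k : ℕ → ℕ) {s : ℕ} (hs : 1 ≤ s) (hsm : s ≤ (p s).length) (q : PolyMapF2 s) (hq : q.DegLE 3) (hlen : q.length = (p s).length)
    (g₀ : Tup s (p s).length) (hg₀ : IsUnit g₀.1 ∧ IsUnit g₀.2.2.1)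
    (hrel : ∀ x, q.eval x = affOut g₀.2.2.1 g₀.2.2.2 ((p s).eval (g₀.1.mulVec x + g₀.2.1))) (r : List Bool) :
    PEAInst.untypedCode (core T (s, (q.map (List.map (List.map Fin.val)), k s)) r) ∈ Side p k s := by
  have hlq' : (q.map (List.map (List.map Fin.val))).length = (p s).length := by rw [List.length_map, hlen]
  have hcore : core T (s, (q.map (List.map (List.map Fin.val)), k s)) r =
      (s, (outMapG s (p s).length T (q.map (List.map (List.map Fin.val))) r, k s)) := by
    simp only [core, hlq', min_eq_left hsm]
  have hwf : ∀ u ∈ outMapG s (p s).length T (q.map (List.map (List.map Fin.val))) r, ∀ μ ∈ u,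
      (∀ i ∈ μ, i < s) ∧ μ.length ≤ 3 := fun u hu μ hμ => outMap_wf hu hμ
  have henc : PEAInst.untypedCode (s, (outMapG s (p s).length T (q.map (List.map (List.map Fin.val))) r, k s)) =
      PEAInst.encoding.encode (⟨s, (liftT s hs (outMapG s (p s).length T (q.map (List.map (List.map Fin.val))) r),
        k s)⟩ : PEAInst) := by
    rw [PEAInst.encode_eq_untypedCode]
    show _ = PEAInst.untypedCode (s, ((liftT s hs _).map (List.map (List.map Fin.val)), k s))
    rw [untyped_liftT hs fun u hu μ hμ => (hwf u hu μ hμ).1]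
  rw [hcore, henc]
  refine ⟨_, ⟨⟨hs, rfl, degLE_liftT hs fun u hu μ hμ => (hwf u hu μ hμ).2, ?_⟩, rfl⟩, rfl⟩
  -- affine equivalence with `p s`: compose the read-off group element with `g₀`
  refine ⟨g₀.1 * matT s (gA s T r), g₀.1.mulVec (vecT s (gb s T r)) + g₀.2.1,
    matT (p s).length (gB s (p s).length T r) * g₀.2.2.1,
    (matT (p s).length (gB s (p s).length T r)).mulVec g₀.2.2.2 + vecT (p s).length (gc s (p s).length T r),
    hg₀.1.mul (isUnit_matT_sel _ _ _), (isUnit_matT_sel _ _ _).mul hg₀.2, fun x => ?_⟩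
  show (liftT s hs _).eval x = _
  rw [eval_liftT hs (fun u hu μ hμ => (hwf u hu μ hμ).1), outMapG, evalM_outMap q hq, affOut_matT_cast hlen, hrel,
    affOut_affOut, mulVec_affine]

/-! ### The three semantic fields of the kit, for one family `p` -/

section Fields

variable (p : (s : ℕ) → PolyMapF2 s) (k : ℕ → ℕ) (hd : ∀ s, (p s).DegLE 3) (hsm : ∀ s, s ≤ (p s).length)

/-- The planted sampler built on a string function `F` computing the core map on base instances. [folklore] -/
def sampOf (F : List Bool → List Bool) (c : ℕ → ℕ) : RandAlg ℕ (List Bool) := ⟨fun n r => F (boolPair (unE n) r), c⟩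

/-- The re-randomiser built on a string function `Fr` computing the core map. [folklore] -/
def rerOf (Fr : List Bool → List Bool) (c : ℕ → ℕ) : RandAlg (List Bool) (List Bool) := ⟨fun w ρ => Fr (boolPair w ρ), c⟩

include hd hsm in
/-- **Support of the planted sampler**: every output on `1ⁿ` is an orbit instance of size `n + 1`.
[cite: BogdanovTrevisan2006, Def. 2.1] -/
theorem sampOf_support {F : List Bool → List Bool}
    (hF : ∀ x : ℕ × List Bool, F (boolPair (unE x.1) x.2) =
      PEAInst.untypedCode (core T (PEAInst.untyped ⟨x.1 + 1, (p (x.1 + 1), k (x.1 + 1))⟩) x.2))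
    (c : ℕ → ℕ) (n : ℕ) (w : List Bool) (hw : w ∈ ((sampOf F c).outputPMF unaryEncodeNat n).support) :
    w ∈ Side p k (n + 1) := by
  obtain ⟨r, -, rfl⟩ := (PMF.mem_support_map_iff _ _ _).1 hw
  show F (boolPair (unE n) r.toList) ∈ _
  rw [hF (n, r.toList)]
  exact core_mem_side p k (Nat.succ_pos n) (hsm _) _ (hd _) rfl ⟨1, 0, 1, 0⟩ ⟨isUnit_one, isUnit_one⟩
    (fun x => by rw [Matrix.one_mulVec, add_zero, affOut_one_zero _ (PolyMapF2.length_eval _ _)]) r.toList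

include hsm in
/-- **The re-randomiser stays in the orbit slice.** [folklore] -/
theorem rerOf_side {Fr : List Bool → List Bool}
    (hFr : ∀ x : (ℕ × (List (List (List ℕ)) × ℕ)) × List Bool,
      Fr (boolPair (PEAInst.untypedCode x.1) x.2) = PEAInst.untypedCode (core T x.1 x.2))
    (c : ℕ → ℕ) (s : ℕ) (w : List Bool) (hw : w ∈ Side p k s) (w' : List Bool)
    (hw' : w' ∈ ((rerOf Fr c).outputPMF id w).support) : w' ∈ Side p k s := by
  obtain ⟨I, ⟨⟨hs1, hk, hdeg, haff⟩, hIs⟩, rfl⟩ := hw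
  obtain ⟨s', q, j⟩ := I
  simp only at hIs hs1 hk hdeg haff
  subst hIs; subst hk
  obtain ⟨ρ, -, rfl⟩ := (PMF.mem_support_map_iff _ _ _).1 hw'
  show Fr (boolPair (PEAInst.encoding.encode ⟨s', (q, k s')⟩) ρ.toList) ∈ _
  obtain ⟨A₀, b₀, B₀, c₀, hA₀, hB₀, hrel⟩ := haff
  have key := hFr ((PEAInst.untyped ⟨s', (q, k s')⟩), ρ.toList)
  rw [← PEAInst.encode_eq_untypedCode] at key
  rw [key]
  exact core_mem_side p k hs1 (hsm _) q hdeg (AffEquiv.length_eq ⟨A₀, b₀, B₀, c₀, hA₀, hB₀, hrel⟩)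
    ⟨A₀, b₀, B₀, c₀⟩ ⟨hA₀, hB₀⟩ hrel ρ.toList

include hd hsm in
/-- **The re-randomised law is `1/16`-close to the planted law** on every orbit point, as soon as both
coin budgets cover the coins read. [folklore] -/
theorem rerOf_close {F Fr : List Bool → List Bool}
    (hF : ∀ x : ℕ × List Bool, F (boolPair (unE x.1) x.2) =
      PEAInst.untypedCode (core T (PEAInst.untyped ⟨x.1 + 1, (p (x.1 + 1), k (x.1 + 1))⟩) x.2))
    (hFr : ∀ x : (ℕ × (List (List (List ℕ)) × ℕ)) × List Bool,
      Fr (boolPair (PEAInst.untypedCode x.1) x.2) = PEAInst.untypedCode (core T x.1 x.2))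
    {cS cR : ℕ → ℕ} (hcS : ∀ n, need (n + 1) (p (n + 1)).length T ≤ cS n)
    (hcR : ∀ s m ℓ, s ≤ ℓ → m ≤ ℓ → need s m T ≤ cR ℓ) (n : ℕ) (w : List Bool) (hw : w ∈ Side p k (n + 1))
    (E : Set (List Bool)) : (rerOf Fr cR).pr id w E ≤ (sampOf F cS).pr unaryEncodeNat n E + 1 / 16 := by
  obtain ⟨I, ⟨⟨hs1, hk, hdeg, haff⟩, hIs⟩, rfl⟩ := hw
  obtain ⟨s', q, j⟩ := I
  simp only at hIs hs1 hk hdeg haff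
  subst hIs; subst hk
  obtain ⟨A₀, b₀, B₀, c₀, hA₀, hB₀, hrel⟩ := haff
  have hlq : q.length = (p (n + 1)).length := AffEquiv.length_eq ⟨A₀, b₀, B₀, c₀, hA₀, hB₀, hrel⟩
  have hwq : PEAInst.encoding.encode (⟨n + 1, (q, k (n + 1))⟩ : PEAInst) =
      PEAInst.untypedCode (n + 1, (q.map (List.map (List.map Fin.val)), k (n + 1))) := by
    rw [PEAInst.encode_eq_untypedCode]; rfl
  rw [RandAlg.pr_eq_uniformProb, RandAlg.pr_eq_uniformProb, uniformProb_eq_cnt_div, uniformProb_eq_cnt_div, hwq,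
    show (rerOf Fr cR).coinLen = cR from rfl, show (sampOf F cS).coinLen = cS from rfl]
  simp only [id, length_unE]
  -- both run maps are the core map
  have hcq : ∀ ρ, core T (n + 1, (q.map (List.map (List.map Fin.val)), k (n + 1))) ρ =
      (n + 1, (outMapG (n + 1) (p (n + 1)).length T (q.map (List.map (List.map Fin.val))) ρ, k (n + 1))) := by
    intro ρ
    have h1 : (q.map (List.map (List.map Fin.val))).length = (p (n + 1)).length := by rw [List.length_map, hlq]
    simp only [core, h1, min_eq_left (hsm (n + 1))]
  have hcp : ∀ r, core T (PEAInst.untyped ⟨n + 1, (p (n + 1), k (n + 1))⟩) r =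
      (n + 1, (outMapG (n + 1) (p (n + 1)).length T ((p (n + 1)).map (List.map (List.map Fin.val))) r,
        k (n + 1))) := by
    intro r
    have h1 : ((p (n + 1)).map (List.map (List.map Fin.val))).length = (p (n + 1)).length := List.length_map _
    simp only [core, PEAInst.untyped, h1, min_eq_left (hsm (n + 1))]
  have hrer : cnt (cR (PEAInst.untypedCode (n + 1, (q.map (List.map (List.map Fin.val)), k (n + 1)))).length)
      {y | (rerOf Fr cR).run (PEAInst.untypedCode (n + 1, (q.map (List.map (List.map Fin.val)), k (n + 1)))) y ∈ E} =
      cnt (cR (PEAInst.untypedCode (n + 1, (q.map (List.map (List.map Fin.val)), k (n + 1)))).length)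
        {ρ | PEAInst.untypedCode (n + 1, (outMapG (n + 1) (p (n + 1)).length T
          (q.map (List.map (List.map Fin.val))) ρ, k (n + 1))) ∈ E} :=
    cnt_congr fun ρ _ => by
      rw [Set.mem_setOf_eq, Set.mem_setOf_eq, show (rerOf Fr cR).run _ ρ = Fr (boolPair _ ρ) from rfl,
        hFr (_, ρ), hcq]
  have hsamp : cnt (cS n) {y | (sampOf F cS).run n y ∈ E} = cnt (cS n)
      {r | PEAInst.untypedCode (n + 1, (outMapG (n + 1) (p (n + 1)).length T
        ((p (n + 1)).map (List.map (List.map Fin.val))) r, k (n + 1))) ∈ E} :=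
    cnt_congr fun r _ => by
      rw [Set.mem_setOf_eq, Set.mem_setOf_eq, show (sampOf F cS).run n r = F (boolPair (unE n) r) from rfl,
        hF (n, r), hcp]
  rw [hrer, hsamp]
  have hN' : need (n + 1) (p (n + 1)).length T ≤
      cR (PEAInst.untypedCode (n + 1, (q.map (List.map (List.map Fin.val)), k (n + 1)))).length := by
    refine hcR _ _ _ ((hsm _).trans ?_) ?_ <;>
    · rw [← hlq, ← List.length_map (f := List.map (List.map Fin.val)) (as := q)]
      exact length_le_length_untypedCode _ _ _
  have := close (p (n + 1)) q (hd _) hdeg hlq ⟨(A₀, b₀, B₀, c₀), hA₀, hB₀⟩ hrel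
    (fun Q => PEAInst.untypedCode (n + 1, (Q, k (n + 1)))) E (hcS n) hN'
  linarith [two_mul_pow_T_le]

end Fields

end OKit

section Main

open OKit

/-- **The orbit kit of a `P`-uniform pair of cubic families** (stub `stub_orbitKit` of the line
`orbit-pair-rsr`): uniform planted samplers of the two orbits with one honest coin polynomial, and an
in-orbit re-randomiser `1/16`-close to the planted law on every orbit point.
[cite: BogdanovTrevisan2006, Def. 2.1 (samplable ensembles)] -/
theorem stub_orbitKit (p₀ p₁ : (s : ℕ) → PolyMapF2 s) (k : ℕ → ℕ) (hu₀ : IsPUniform p₀ k) (hu₁ : IsPUniform p₁ k)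
    (hd₀ : ∀ s, (p₀ s).DegLE 3) (hd₁ : ∀ s, (p₁ s).DegLE 3)
    (hlen : ∀ s, s ≤ (p₀ s).length ∧ s ≤ (p₁ s).length) : Nonempty (OrbitKit p₀ p₁ k) := by
  -- uniform data, indexed by the side
  have hu : ∀ b, IsPUniform (bySide p₀ p₁ b) k := fun b => by cases b <;> assumption
  have hd : ∀ b s, ((bySide p₀ p₁ b) s).DegLE 3 := fun b => by cases b <;> assumption
  have hsm : ∀ b s, s ≤ ((bySide p₀ p₁ b) s).length := fun b s => by
    cases b
    · exact (hlen s).1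
    · exact (hlen s).2
  -- the base instances in `FP`, and polynomial bounds on the number of coordinates
  have hinst : ∀ b, CodeFP unE PEAInst.untypedCode (fun s => PEAInst.untyped ⟨s, ((bySide p₀ p₁ b) s, k s)⟩) :=
    fun b => by
      obtain ⟨f, hf, hfs⟩ := hu b
      exact ⟨f, hf, fun s => by rw [hfs, PEAInst.encode_eq_untypedCode]⟩
  have hbound : ∀ b, ∃ M : Polynomial ℕ, ∀ s, ((bySide p₀ p₁ b) s).length ≤ M.eval s := fun b => by
    obtain ⟨f, hf, hfs⟩ := hu b
    obtain ⟨M, hM⟩ := exists_poly_length_le_of_mem_FP hf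
    refine ⟨M, fun s => ?_⟩
    have h1 := length_le_length_untypedCode s (k s) (((bySide p₀ p₁ b) s).map (List.map (List.map Fin.val)))
    rw [List.length_map] at h1
    have h2 : (PEAInst.untypedCode (s, (((bySide p₀ p₁ b) s).map (List.map (List.map Fin.val)), k s))).length ≤
        M.eval s := by
      have := hM (unE s)
      rwa [hfs, PEAInst.encode_eq_untypedCode, length_unE] at this
    exact h1.trans h2
  choose M hM using hbound
  -- the two string functions
  have hsampFP : ∀ b, CodeFP (pairE unE strE) PEAInst.untypedCode
      (fun x => core T (PEAInst.untyped ⟨x.1 + 1, ((bySide p₀ p₁ b) (x.1 + 1), k (x.1 + 1))⟩) x.2) := by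
    intro b
    have h1 := unSucc.comp (fst unE strE)
    have h2 := (hinst b).comp h1
    have h3 := h2.pair (snd unE strE)
    have h4 := (coreFP T).comp h3
    exact h4.congr fun _ => rfl
  choose F hF hFspec using hsampFP
  obtain ⟨Fr, hFr, hFrspec⟩ := coreFP T
  -- coin budgets
  obtain ⟨sampCoins, hsC⟩ := exists_sampCoins (M false) (M true)
  have hsampCoins : ∀ b n, need (n + 1) ((bySide p₀ p₁ b) (n + 1)).length T ≤ sampCoins.eval n := fun b n =>
    hsC n _ (by cases b <;> linarith [hM false (n + 1), hM true (n + 1)])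
  obtain ⟨rerCoins, hrerCoins⟩ := exists_rerCoins
  refine ⟨⟨fun b => sampOf (F b) (fun ℓ => sampCoins.eval ℓ), fun b => ⟨?_, sampCoins, fun n => le_rfl⟩, sampCoins,
    fun b ℓ => rfl, fun b => sampOf_support _ k (hd b) (hsm b) (hFspec b) _,
    rerOf Fr (fun ℓ => rerCoins.eval ℓ), ⟨?_, rerCoins, fun n => le_rfl⟩, rerCoins, fun ℓ => rfl,
    fun b => rerOf_side _ k (hsm b) hFrspec _,
    fun b => rerOf_close _ k (hd b) (hsm b) (hFspec b) hFrspec (hsampCoins b) hrerCoins⟩⟩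
  · exact PolyTimeComputable.of_encode_eq (f := F b) (ea := id) (eb := id)
      (fun x : ℕ × List Bool => boolPair (unE x.1) x.2) (fun _ => rfl) (fun _ => rfl) (hF b)
  · exact PolyTimeComputable.of_encode_eq (f := Fr) (ea := id) (eb := id)
      (fun x : List Bool × List Bool => boolPair x.1 x.2) (fun _ => rfl) (fun _ => rfl) hFr

end Main

end Summit.PneNP.PneNP.Cruxes.PeaWorstToAvg.OrbitPairRsr
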